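import Mathlib.RingTheory.MvPolynomial.Basic
import Mathlib.RingTheory.Polynomial.Basic
import Mathlib.RingTheory.Ideal.Quotient.Operations
import Mathlib.RingTheory.Ideal.Maximal
import Mathlib.Algebra.Polynomial.Div
import Mathlib.Algebra.CharP.Two
import Mathlib.Tactic.Ring
import Mathlib.Tactic.LinearCombination
import Mathlib.Tactic.FinCases
import Summits.ResolutionOfSingularities.ResolutionOfSingularities.Theorems.FrobeniusLadderFInjectiveMacaulayficationFedderOrigin
import HarnessLib

/-!
# The threefold parameter witness: `(x₀ + x₁, x₂, x₃)` is not Frobenius closed in characteristic 2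

Support file for crux stmt-ResolutionOfSingularities-15315
(`FrobeniusLadder.FInjectiveMacaulayfication`, line `Sketch`, lead seat c7): stub
`stub_threefoldParameterWitness` of the §13 THREEFOLD CALIBRATION (dimension `3`, characteristic `2`) —
conjunct (a) of the route's support item `ThreefoldFInjectiveBlowup` (stmt-ResolutionOfSingularities-17936).

Let `k` be a field of characteristic `2`, `S = k[X₀, X₁, X₂, X₃]`,
`f = X₀²X₁ + X₁²X₂ + X₂²X₀ + X₀X₃³ + X₁X₂X₃²`, `A = S/(f)` (the germ of the calibration), `uᵢ` the class
of `Xᵢ`, and `I = (u₀ + u₁, u₂, u₃) ⊆ A`. Then (`stub_threefoldParameterWitness`):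

* `rad I` is the maximal ideal of the origin. Indeed `u₀³ ∈ I`: in `A` the relation `f = 0` gives
  `u₀³ = u₀²(u₀+u₁) + (u₁² + u₂u₀ + u₁u₃²)·u₂ + (u₀u₃²)·u₃`; hence all `uᵢ ∈ rad I`. With the evaluation
  at the origin `ε : A → k` (well defined as `f(0) = 0`, surjective, so `ker ε` is maximal) one gets
  `rad I ≤ ker ε` (the generators of `I` die) and `ker ε ≤ rad I` (a polynomial with zero constant
  coefficient lies in `(X₀, …, X₃)`, `Fedder.span_range_X_eq_ker`), so `rad I = ker ε`.
* `u₀² ∉ I`: the `k`-algebra map `S → k[T]/(T³)`, `X₀, X₁ ↦ T`, `X₂, X₃ ↦ 0` sends `f ↦ T³ = 0`, hence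
  factors through `A`; it kills `u₀ + u₁ ↦ 2T = 0` (characteristic `2`), `u₂`, `u₃`, hence `I`, but
  sends `u₀² ↦ T² ≠ 0` (`T³ ∤ T²`).
* `(u₀²)² = u₀⁴ ∈ I^[2] = (z² : z ∈ I)`: the characteristic-`2` identity
  `u₀⁴ = (u₀² + u₁u₂)(u₀+u₁)² + (u₀u₁ + u₁² + u₀u₂ + u₁u₃²)·u₂² + (u₀u₁u₃ + u₁²u₂ + u₀u₂u₃)·u₃²`
  (it reads `X₀⁴ = (X₁+X₂)·f + … − 2(X₀³X₁ + X₀X₁²X₂)` in `S`).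

So the parameter ideal `I` of the Cohen–Macaulay local ring of the threefold at its origin is not
Frobenius closed: the origin is not F-injective (compare Fedder's criterion, [Fedder1983] Prop. 1.7:
`f ∈ (X₀², …, X₃²)`). Template: `cpSpecimenNotFClosed_proof` (the Cossart–Piltant specimen).
-/

-- single-problem summit: the doubled namespace component is forced
set_option linter.dupNamespace false

namespace Summit.ResolutionOfSingularities.ResolutionOfSingularities.Theorems.FInjectiveMacaulayfication.ThreefoldParameterWitness

open MvPolynomial
open Summit.ResolutionOfSingularities.ResolutionOfSingularities.Theorems.FInjectiveMacaulayfication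

/-- **The threefold parameter witness** (registered stub `stub_threefoldParameterWitness` of the §13
calibration; conjunct (a) of route item stmt-ResolutionOfSingularities-17936). For a field `k` of
characteristic `2`, `A = k[X₀,…,X₃]/(X₀²X₁ + X₁²X₂ + X₂²X₀ + X₀X₃³ + X₁X₂X₃²)`, `uᵢ` the classes of the
variables and `I = (u₀ + u₁, u₂, u₃)`: `rad I` is maximal (it is the maximal ideal of the origin, the
kernel of the evaluation `A → k` at `0`, because `u₀³ ∈ I`), `u₀² ∉ I` (evaluate `X₀, X₁ ↦ T`,
`X₂, X₃ ↦ 0` into `k[T]/(T³)`: `I ↦ 0` as `2T = 0`, but `u₀² ↦ T² ≠ 0`), and `(u₀²)² ∈ I^[2]`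
(`u₀⁴ = (u₀² + u₁u₂)(u₀+u₁)² + (…)u₂² + (…)u₃²` in characteristic `2`). Hence the parameter ideal `I`
is not Frobenius closed: the origin of the threefold is not F-injective.
[cite: Fedder1983, Prop. 1.7] -/
theorem stub_threefoldParameterWitness : ∀ (k : Type) [Field k] [CharP k 2] (f : MvPolynomial (Fin 4) k),
    f = MvPolynomial.X 0 ^ 2 * MvPolynomial.X 1 + MvPolynomial.X 1 ^ 2 * MvPolynomial.X 2 + MvPolynomial.X 2 ^ 2 * MvPolynomial.X 0 + MvPolynomial.X 0 * MvPolynomial.X 3 ^ 3 + MvPolynomial.X 1 * MvPolynomial.X 2 * MvPolynomial.X 3 ^ 2 →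
    ∀ (u : Fin 4 → MvPolynomial (Fin 4) k ⧸ Ideal.span {f}),
      u = (fun i : Fin 4 => Ideal.Quotient.mk (Ideal.span {f}) (MvPolynomial.X i)) →
      (Ideal.span {u 0 + u 1, u 2, u 3}).radical.IsMaximal ∧ u 0 ^ 2 ∉ Ideal.span {u 0 + u 1, u 2, u 3} ∧
        (u 0 ^ 2) ^ 2 ∈ Ideal.span ((fun z : MvPolynomial (Fin 4) k ⧸ Ideal.span {f} => z ^ 2) ''
          (Ideal.span {u 0 + u 1, u 2, u 3} : Set (MvPolynomial (Fin 4) k ⧸ Ideal.span {f}))) := by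
  intro k _ _ f hf u hu
  set I : Ideal (MvPolynomial (Fin 4) k ⧸ Ideal.span {f}) := Ideal.span {u 0 + u 1, u 2, u 3} with hI
  have hu' : ∀ i, u i = Ideal.Quotient.mk (Ideal.span {f}) (X i) := fun i => by rw [hu]
  -- `f ∈ (f)`, written out
  have hfmem : (X 0 ^ 2 * X 1 + X 1 ^ 2 * X 2 + X 2 ^ 2 * X 0 + X 0 * X 3 ^ 3 + X 1 * X 2 * X 3 ^ 2 :
      MvPolynomial (Fin 4) k) ∈ Ideal.span {f} := by
    rw [← hf]
    exact Ideal.mem_span_singleton_self f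
  -- the defining relation of `A = k[X]/(f)`
  have hrel : u 0 ^ 2 * u 1 + u 1 ^ 2 * u 2 + u 2 ^ 2 * u 0 + u 0 * u 3 ^ 3 + u 1 * u 2 * u 3 ^ 2 = 0 := by
    have h := Ideal.Quotient.eq_zero_iff_mem.mpr hfmem
    simpa only [map_add, map_mul, map_pow, ← hu'] using h
  -- the generators of `I`
  have h01 : u 0 + u 1 ∈ I := Ideal.subset_span (by simp)
  have h2I : u 2 ∈ I := Ideal.subset_span (by simp)
  have h3I : u 3 ∈ I := Ideal.subset_span (by simp)
  refine ⟨?_, ?_, ?_⟩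
  · /- (i) `rad I` is the maximal ideal of the origin: the kernel of the evaluation `ε : A → k` at `0` -/
    have hker0 : ∀ a ∈ Ideal.span {f}, (constantCoeff : MvPolynomial (Fin 4) k →+* k) a = 0 := by
      intro a ha
      obtain ⟨c, rfl⟩ := Ideal.mem_span_singleton'.mp ha
      rw [map_mul, hf]
      simp [constantCoeff_X]
    obtain ⟨ε, hε⟩ : ∃ ε : MvPolynomial (Fin 4) k ⧸ Ideal.span {f} →+* k,
        ∀ q, ε (Ideal.Quotient.mk (Ideal.span {f}) q) = constantCoeff q :=
      ⟨Ideal.Quotient.lift (Ideal.span {f}) _ hker0, fun q => Ideal.Quotient.lift_mk _ _ _⟩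
    have hεu : ∀ i, ε (u i) = 0 := fun i => by rw [hu', hε, constantCoeff_X]
    have hεmax : (RingHom.ker ε).IsMaximal :=
      RingHom.ker_isMaximal_of_surjective ε fun a =>
        ⟨Ideal.Quotient.mk (Ideal.span {f}) (C a), by rw [hε, constantCoeff_C]⟩
    -- `u₀³ ∈ I`, hence every variable lies in `rad I`
    have h0rad : u 0 ∈ I.radical := by
      refine ⟨3, ?_⟩
      have h03 : u 0 ^ 3 = u 0 ^ 2 * (u 0 + u 1) + (u 1 ^ 2 + u 2 * u 0 + u 1 * u 3 ^ 2) * u 2 +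
          u 0 * u 3 ^ 2 * u 3 := by
        linear_combination (-1 : MvPolynomial (Fin 4) k ⧸ Ideal.span {f}) * hrel
      rw [h03]
      exact add_mem (add_mem (Ideal.mul_mem_left _ _ h01) (Ideal.mul_mem_left _ _ h2I))
        (Ideal.mul_mem_left _ _ h3I)
    have h1rad : u 1 ∈ I.radical := by
      have h1 : u 1 = (u 0 + u 1) - u 0 := by ring
      rw [h1]
      exact sub_mem (Ideal.le_radical h01) h0rad
    have hurad : ∀ i, u i ∈ I.radical := by
      intro i
      fin_cases i
      · exact h0rad
      · exact h1rad
      · exact Ideal.le_radical h2I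
      · exact Ideal.le_radical h3I
    -- `rad I = ker ε`
    have hradeq : I.radical = RingHom.ker ε := by
      apply le_antisymm
      · rw [hεmax.isPrime.radical_le_iff, hI, Ideal.span_le]
        rintro x (rfl | rfl | rfl) <;>
          simp only [SetLike.mem_coe, RingHom.mem_ker, map_add, hεu, add_zero]
      · intro a ha
        obtain ⟨q, rfl⟩ := Ideal.Quotient.mk_surjective a
        rw [RingHom.mem_ker, hε, ← RingHom.mem_ker, ← Fedder.span_range_X_eq_ker] at ha
        have hle : Ideal.span (Set.range (X : Fin 4 → MvPolynomial (Fin 4) k)) ≤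
            I.radical.comap (Ideal.Quotient.mk (Ideal.span {f})) := by
          rw [Ideal.span_le]
          rintro _ ⟨i, rfl⟩
          rw [SetLike.mem_coe, Ideal.mem_comap, ← hu']
          exact hurad i
        exact hle ha
    rw [hradeq]
    exact hεmax
  · /- (ii) `u₀² ∉ I`: evaluate into `B = k[T]/(T³)`, `X₀, X₁ ↦ T`, `X₂, X₃ ↦ 0` -/
    intro hmem
    set v : Fin 4 → Polynomial k := ![Polynomial.X, Polynomial.X, 0, 0] with hv
    have hv0 : v 0 = Polynomial.X := by simp [hv]
    have hv01 : v 0 + v 1 = 0 := by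
      simp only [hv, Matrix.cons_val_zero, Matrix.cons_val_one]
      exact CharTwo.add_self_eq_zero _
    have hv2 : v 2 = 0 := by simp [hv]
    have hv3 : v 3 = 0 := by simp [hv]
    have hvf : MvPolynomial.aeval v f = Polynomial.X ^ 3 := by
      rw [hf]
      simp only [map_add, map_mul, map_pow, MvPolynomial.aeval_X, hv0, hv2, hv3]
      have hv1 : v 1 = Polynomial.X := by simp [hv]
      rw [hv1]
      ring
    have hψf : ((Ideal.Quotient.mk (Ideal.span {(Polynomial.X : Polynomial k) ^ 3})).comp
        (MvPolynomial.aeval v).toRingHom) f = 0 := by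
      change Ideal.Quotient.mk _ (MvPolynomial.aeval v f) = 0
      rw [hvf]
      exact Ideal.Quotient.eq_zero_iff_mem.mpr (Ideal.mem_span_singleton_self _)
    have hker : ∀ a ∈ Ideal.span {f}, ((Ideal.Quotient.mk (Ideal.span {(Polynomial.X : Polynomial k) ^ 3})).comp
        (MvPolynomial.aeval v).toRingHom) a = 0 := by
      intro a ha
      obtain ⟨c, rfl⟩ := Ideal.mem_span_singleton'.mp ha
      rw [map_mul, hψf, mul_zero]
    obtain ⟨θ, hθ⟩ : ∃ θ : MvPolynomial (Fin 4) k ⧸ Ideal.span {f} →+*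
        Polynomial k ⧸ Ideal.span {(Polynomial.X : Polynomial k) ^ 3},
        ∀ q, θ (Ideal.Quotient.mk (Ideal.span {f}) q) =
          Ideal.Quotient.mk (Ideal.span {(Polynomial.X : Polynomial k) ^ 3}) (MvPolynomial.aeval v q) :=
      ⟨Ideal.Quotient.lift (Ideal.span {f}) _ hker, fun q => Ideal.Quotient.lift_mk _ _ _⟩
    -- `I ≤ ker θ`
    have hIker : I ≤ RingHom.ker θ := by
      rw [hI, Ideal.span_le]
      rintro x (rfl | rfl | rfl)
      · have h : u 0 + u 1 = Ideal.Quotient.mk (Ideal.span {f}) (X 0 + X 1) := by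
          rw [map_add, hu', hu']
        rw [SetLike.mem_coe, RingHom.mem_ker, h, hθ, map_add, MvPolynomial.aeval_X,
          MvPolynomial.aeval_X, hv01, map_zero]
      · rw [SetLike.mem_coe, RingHom.mem_ker, hu', hθ, MvPolynomial.aeval_X, hv2, map_zero]
      · rw [SetLike.mem_coe, RingHom.mem_ker, hu', hθ, MvPolynomial.aeval_X, hv3, map_zero]
    -- but `θ (u₀²) = T² ≠ 0`
    have h0 : θ (u 0 ^ 2) = 0 := hIker hmem
    rw [map_pow, hu', hθ, MvPolynomial.aeval_X, hv0, ← map_pow, Ideal.Quotient.eq_zero_iff_mem,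
      Ideal.mem_span_singleton, Polynomial.X_pow_dvd_iff] at h0
    have h22 := h0 2 (by norm_num)
    rw [Polynomial.coeff_X_pow, if_pos rfl] at h22
    exact one_ne_zero h22
  · /- (iii) `(u₀²)² ∈ I^[2]`: an explicit identity in characteristic `2` -/
    have h2 : (2 : MvPolynomial (Fin 4) k ⧸ Ideal.span {f}) = 0 := by
      rw [← map_ofNat (Ideal.Quotient.mk (Ideal.span {f})) 2, CharTwo.two_eq_zero, map_zero]
    have hsq : ∀ z ∈ I, z ^ 2 ∈ Ideal.span ((fun z : MvPolynomial (Fin 4) k ⧸ Ideal.span {f} => z ^ 2) ''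
        (I : Set (MvPolynomial (Fin 4) k ⧸ Ideal.span {f}))) :=
      fun z hz => Ideal.subset_span ⟨z, hz, rfl⟩
    have hid : (u 0 ^ 2) ^ 2 = (u 0 ^ 2 + u 1 * u 2) * (u 0 + u 1) ^ 2 +
        (u 0 * u 1 + u 1 ^ 2 + u 0 * u 2 + u 1 * u 3 ^ 2) * u 2 ^ 2 +
        (u 0 * u 1 * u 3 + u 1 ^ 2 * u 2 + u 0 * u 2 * u 3) * u 3 ^ 2 := by
      linear_combination (-(u 1 + u 2)) * hrel + (-(u 0 ^ 3 * u 1 + u 0 * u 1 ^ 2 * u 2)) * h2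
    rw [hid]
    exact add_mem (add_mem (Ideal.mul_mem_left _ _ (hsq _ h01)) (Ideal.mul_mem_left _ _ (hsq _ h2I)))
      (Ideal.mul_mem_left _ _ (hsq _ h3I))

end Summit.ResolutionOfSingularities.ResolutionOfSingularities.Theorems.FInjectiveMacaulayfication.ThreefoldParameterWitness
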